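import Summits.Parity.GeneralizedHardyLittlewood.Theorems.GreenTaoLevelTwoGITwoCyclicInverseBohrSize

/-!
# Route `GreenTaoLevelTwo`, crux `GITwo` (stmt-Parity-21275), line `birth`, stub `stub_cyclicInverse`:
# Bohr sets in `ℤ/Nℤ` are large — the printed form `#B(S, ρ) ≥ (ρ/2)^d N`

Seventeenth helper file toward the XL stub `stub_cyclicInverse` (B. Green, T. Tao, arXiv:math/0503014,
Thm. 68 = PEMS 51 (2008) Thm. 12.8): the radius-`ρ` form of GT08a arXiv Lemma 35 (lower bound),
deduced from the box form `card_bohr_ge` (file `…BohrSize`, radius `1/L`) with `L = ⌈1/ρ⌉ ≤ 2/ρ`.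
Bohr sets are spelled def-free through `ZMod.toAddCircle` as in the sibling files.

* `card_bohr_ge_rho` — for `0 < ρ ≤ 1` and `S ⊆ ℤ/Nℤ` with `d = #S`:
  `(ρ/2)^d · N ≤ #{x : ‖toAddCircle(xξ)‖ < ρ ∀ ξ ∈ S}`.

References: [GreenTao2008U3Inverse] arXiv:math/0503014, Lemma 35 ("`|B(S,ρ)| ≥ ρ^d N`"; the factor
`2^{-d}` is the price of integer box counts and is immaterial for the line).
-/

namespace Summit.Parity.GeneralizedHardyLittlewood.GreenTaoLevelTwoGITwoCyclicInverse

open Finset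

variable {N : ℕ} [NeZero N]

/-- **GT08a arXiv Lemma 35 (lower bound), radius form**: `#B(S,ρ) ≥ (ρ/2)^{#S} N` for `0 < ρ ≤ 1`.
[cite: GreenTao2008U3Inverse, Lemma 35] -/
theorem card_bohr_ge_rho (S : Finset (ZMod N)) {ρ : ℝ} (hρ : 0 < ρ) (hρ1 : ρ ≤ 1) :
    (ρ / 2) ^ #S * (N : ℝ) ≤
      #{x : ZMod N | ∀ ξ ∈ S, ‖ZMod.toAddCircle (x * ξ)‖ < ρ} := by
  classical
  set L : ℕ := ⌈1 / ρ⌉₊ with hL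
  have hLpos : 0 < L := Nat.ceil_pos.mpr (by positivity)
  have hLr : (0 : ℝ) < L := by exact_mod_cast hLpos
  have hLle : (L : ℝ) ≤ 2 / ρ := by
    have h1 : (L : ℝ) < 1 / ρ + 1 := Nat.ceil_lt_add_one (by positivity)
    have h2 : (1 : ℝ) ≤ 1 / ρ := by rw [le_div_iff₀ hρ]; linarith
    have : (2 : ℝ) / ρ = 1 / ρ + 1 / ρ := by ring
    linarith
  have hinv : 1 / (L : ℝ) ≤ ρ := by
    rw [div_le_iff₀ hLr]
    have : (1 : ℝ) / ρ ≤ L := Nat.le_ceil _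
    rw [div_le_iff₀ hρ] at this
    linarith
  -- `B(S, 1/L) ⊆ B(S, ρ)`
  have hmono : #{x : ZMod N | ∀ ξ ∈ S, ‖ZMod.toAddCircle (x * ξ)‖ < 1 / (L : ℝ)} ≤
      #{x : ZMod N | ∀ ξ ∈ S, ‖ZMod.toAddCircle (x * ξ)‖ < ρ} := by
    refine card_le_card fun x hx => ?_
    rw [mem_filter] at hx ⊢
    exact ⟨hx.1, fun ξ hξ => (hx.2 ξ hξ).trans_le hinv⟩
  have hbox := card_bohr_ge S hLpos
  -- `(ρ/2)^d N ≤ N / L^d`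
  have hcmp : (ρ / 2) ^ #S * (N : ℝ) ≤ (N : ℝ) / (L : ℝ) ^ #S := by
    rw [le_div_iff₀ (by positivity)]
    have h1 : (ρ / 2) * L ≤ 1 := by
      calc (ρ / 2) * L ≤ (ρ / 2) * (2 / ρ) := by gcongr
        _ = 1 := by field_simp
    have h2 : ((ρ / 2) * L) ^ #S ≤ 1 := pow_le_one₀ (by positivity) h1
    calc (ρ / 2) ^ #S * (N : ℝ) * (L : ℝ) ^ #S = ((ρ / 2) * L) ^ #S * N := by rw [mul_pow]; ring
      _ ≤ 1 * N := by gcongr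
      _ = N := one_mul _
  calc (ρ / 2) ^ #S * (N : ℝ) ≤ (N : ℝ) / (L : ℝ) ^ #S := hcmp
    _ ≤ _ := hbox
    _ ≤ _ := by exact_mod_cast hmono

end Summit.Parity.GeneralizedHardyLittlewood.GreenTaoLevelTwoGITwoCyclicInverse
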